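import Summits.AtomisticToContinuum.Crystallization.Theorems.FrustratedLawDichotomyStrainedPatchConeWitnessKitL1

/-!
# ConeWitness kit, part 4 — the far-class certificate PARAMETRIC in the tolerances `(η₀, θ)` with `η₀ + θ < 1/8`, and the BAND-95 instance `θ := 7/100`
# (27623 `AperiodicFrustratedLawGap`, T-far lane SECTOR-95; decomp-a2c hand 2, generation 42; structural #34; DEF-FREE)

The tree's far-class certificate `not_goodAtScale_of_shellFrame_record` (lens-5 g95, `…ConeWitnessKitL1`) is instanced at the RECORD direction tolerance
`θ₀ = 17/500`.  The census BAND-95 witness of record (`W95band_B_A020`, critic row 1586 (C): «ShellFrame direction tolerance of the band witness θ = 0.06475 >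
record θ₀ = 17/500 ⇒ far class via L1/L2 re-instanced at θ := 7/100 (η₀ + θ = 0.12 < 1/8), thin») needs a wider tolerance.  «Most general landed lemma first,
then specialise»:

* §1 `hcpExcludedNearFcc_of_lt_eighth` — L2 needs only `η₀ + θ < 1/8` (since `2 (η₀ + θ) < 1/4 < 1/2 < 1/√3`), the SAME side condition as L1; hence
  ★★ `not_goodAtScale_of_shellFrame_of_lt : η₀ + θ < 1/8 → ShellFrame y i (nearestDist y i) θ g s → (minimax floor at η₀) → ¬GoodAtScale η₀ D y i` —
  the far-class certificate for EVERY tolerance pair under the one L1 side condition; `ShellFrame.mono` (the frame clause is monotone in `θ`).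
* §2 instances at `η₀ = 1/20`: ★ `not_goodAtScale_of_shellFrame_band` (`θ = 7/100`, the BAND-95 re-instance asked by the critic; `1/20 + 7/100 = 3/25 < 1/8`)
  and `not_goodAtScale_of_shellFrame_of_le_band` (any `θ ≤ 7/100`, e.g. the record `17/500` or the witness's `0.06475`, through `ShellFrame.mono`).

0 sorry; standard axioms; no definitions / instances / notation.  Imports `…ConeWitnessKitL1` only.  `--supports stmt-AtomisticToContinuum-27623`.  [formal bookkeeping]
-/

namespace Summit.AtomisticToContinuum.Crystallization.Theorems.FrustratedLawDichotomyStrainedPatchConeWitnessKit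

open scoped BigOperators RealInnerProductSpace
open Summit.AtomisticToContinuum.Crystallization.Theorems.ChargedEnergyGapNegative (E3)

section FarClassWide

open Literature.Geometry.DiscreteGeometry (fccKissingPattern nearestDist)
open Summit.AtomisticToContinuum.Crystallization.Theorems.FrustratedLawDichotomyMotifLemmas (GoodAtScale)

/-! ## §1. The far-class certificate for every `(η₀, θ)` with `η₀ + θ < 1/8` -/

/-- `√3 < 2`, hence `1/2 < 1/√3`. [bookkeeping] -/
theorem one_half_lt_one_div_sqrt_three : (1 : ℝ) / 2 < 1 / Real.sqrt 3 := by
  have h3 : Real.sqrt 3 < 2 := by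
    rw [show (2 : ℝ) = Real.sqrt (2 ^ 2) by rw [Real.sqrt_sq (by norm_num)]]
    exact Real.sqrt_lt_sqrt (by norm_num) (by norm_num)
  exact one_div_lt_one_div_of_lt (Real.sqrt_pos.2 (by norm_num)) h3

/-- ★ **L2 under the L1 side condition**: `η₀ + θ < 1/8 ⟹ HcpExcludedNearFcc η₀ θ` (`2 (η₀ + θ) < 1/4 < 1/√3`). [formal bookkeeping: `hcpExcludedNearFcc_of_lt`] -/
theorem hcpExcludedNearFcc_of_lt_eighth {η₀ θ : ℝ} (hsmall : η₀ + θ < 1 / 8) : HcpExcludedNearFcc η₀ θ := by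
  refine hcpExcludedNearFcc_of_lt ?_
  have h := one_half_lt_one_div_sqrt_three
  linarith

/-- ★★ **THE FAR-CLASS CERTIFICATE, PARAMETRIC**: for ANY tolerances with `η₀ + θ < 1/8`, fcc shell frame data `(θ, g, s)` at a site plus the Kabsch / minimax floor
`hK` of the FORCED assignment over all linear isometries at tolerance `η₀` ⟹ `¬GoodAtScale η₀ D y i` (L1 `forcedAssignmentFcc_of_lt` and L2 `hcpExcludedNearFcc_of_lt_eighth`
discharged under the one side condition). [formal bookkeeping: `not_goodAtScale_of_shellFrame`] -/
theorem not_goodAtScale_of_shellFrame_of_lt {η₀ θ D : ℝ} (hsmall : η₀ + θ < 1 / 8) {N : ℕ} {y : Fin N → E3} {i : Fin N} (hy : Function.Injective y)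
    {g : E3 →ₗᵢ[ℝ] E3} {s : ↥fccKissingPattern → E3} (hfr : ShellFrame y i (nearestDist y i) θ g s)
    (hK : ∀ A' : E3 →ₗᵢ[ℝ] E3, ∃ u, η₀ * nearestDist y i ≤ ‖(s u - y i) - nearestDist y i • A' (u : E3)‖) :
    ¬GoodAtScale η₀ D y i :=
  not_goodAtScale_of_shellFrame (forcedAssignmentFcc_of_lt hsmall) (hcpExcludedNearFcc_of_lt_eighth hsmall) hy hfr hK

/-- The shell-frame datum is MONOTONE in the direction tolerance: `θ ≤ θ' ⟹ ShellFrame y i d θ g s → ShellFrame y i d θ' g s` (only the frame clause mentions `θ`).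
[formal bookkeeping] -/
theorem ShellFrame.mono {N : ℕ} {y : Fin N → E3} {i : Fin N} {d θ θ' : ℝ} {g : E3 →ₗᵢ[ℝ] E3} {s : ↥fccKissingPattern → E3}
    (h : ShellFrame y i d θ g s) (hle : θ ≤ θ') : ShellFrame y i d θ' g s :=
  ⟨h.1, h.2.1, fun u => (h.2.2.1 u).trans hle, h.2.2.2.1, h.2.2.2.2⟩

/-! ## §2. Instances at the record goodness tolerance `η₀ = 1/20` -/

/-- ★ **BAND-95 INSTANCE** (critic row 1586 (C)): `η₀ = 1/20`, `θ = 7/100` (`3/25 < 1/8`) — fcc shell frame data at direction tolerance `7/100` plus the minimax floor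
at `1/20` ⟹ `¬GoodAtScale (1/20) D y i`.  Serves the census band witness `W95band_B_A020` (measured frame tolerance `0.06475 ≤ 7/100`). [formal bookkeeping] -/
theorem not_goodAtScale_of_shellFrame_band {D : ℝ} {N : ℕ} {y : Fin N → E3} {i : Fin N} (hy : Function.Injective y)
    {g : E3 →ₗᵢ[ℝ] E3} {s : ↥fccKissingPattern → E3} (hfr : ShellFrame y i (nearestDist y i) (7 / 100) g s)
    (hK : ∀ A' : E3 →ₗᵢ[ℝ] E3, ∃ u, 1 / 20 * nearestDist y i ≤ ‖(s u - y i) - nearestDist y i • A' (u : E3)‖) :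
    ¬GoodAtScale (1 / 20) D y i :=
  not_goodAtScale_of_shellFrame_of_lt (by norm_num) hy hfr hK

/-- … and for ANY direction tolerance `θ ≤ 7/100` (the record `17/500`, the witness's own `0.06475`, …) at `η₀ = 1/20`. [formal bookkeeping: `ShellFrame.mono`] -/
theorem not_goodAtScale_of_shellFrame_of_le_band {θ D : ℝ} (hθ : θ ≤ 7 / 100) {N : ℕ} {y : Fin N → E3} {i : Fin N} (hy : Function.Injective y)
    {g : E3 →ₗᵢ[ℝ] E3} {s : ↥fccKissingPattern → E3} (hfr : ShellFrame y i (nearestDist y i) θ g s)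
    (hK : ∀ A' : E3 →ₗᵢ[ℝ] E3, ∃ u, 1 / 20 * nearestDist y i ≤ ‖(s u - y i) - nearestDist y i • A' (u : E3)‖) :
    ¬GoodAtScale (1 / 20) D y i :=
  not_goodAtScale_of_shellFrame_band hy (hfr.mono hθ) hK

end FarClassWide

end Summit.AtomisticToContinuum.Crystallization.Theorems.FrustratedLawDichotomyStrainedPatchConeWitnessKit
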